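import Summits.QuantumFields.YangMills.Theorems.FibreConvexityTailTwoSidedTailLChernoffOnEvent

/-!
# Crux `TwoSidedTailL` (stmt-QuantumFields-25567, route `FibreConvexityTail`, rung-R3 leaf `YM3TorusSU2`) — LINE «birth», SKELETON v2
# (lead seat ym-line-fct-p1 g2): the registered two-layer composition with the LANDED stub S2 imported from the tree

The BC3 skeleton registered at birth (`TwoSidedTailL_birth.lean`, sha 9234731e…, planner ym-r3-idea-2 g0) composes the crux from
S1 = `stub_fibreMGF` (sub-Gaussian moment bound on the two-sided event: fibre log-concavity + Herbst + the minimiser's mean bound; XL,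
OPEN) and S2 = `stub_chernoffOnEvent` (Chernoff on the event; M).  S2 and the two posited objects (`twoSidedEvent`, `SubGaussianOnEvent`)
have LANDED in the tree (p610621 `Theorems/FibreConvexityTailDefs.lean`, p611300 `Theorems/FibreConvexityTailTwoSidedTailLChernoffOnEvent.lean`,
seat ym-line-fct-p1 g0), so this v2 skeleton IMPORTS them instead of carrying local copies: exactly ONE `sorry` remains, the registered
signature of `stub_fibreMGF` verbatim, and `TwoSidedTailL_of` concludes the crux BY NAME from it.

STATUS OF S1 (2026-08-28): NOT to be worked before the instrument row JOB B (ym-r3-instr-1; κ₀(K, j+2) = λ_min·L^{2(j+2)}/β_K of the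
horizontal fibre Hessian at window-edge configurations, K ≤ 6) reports — idea-crit-5 V39 prices (1)–(3) are the crux's why-fail:
(i) outer convex window W⁺ ⊇ W in Bałaban's regular chart, (ii) volume-uniform ghost log-det Hessian bound, (iii) κ₀ > 0 uniformly in
(K, j) — the ideator's own correction (HOME STATUS 04:43Z) caps worst-case convexity at fibre scale λ ≲ β_K^{1/2}/p, i.e. the lever as
filed covers heights h > K/2 + O(log p) only.  When S1 is staffed it is expected to be RESHAPED at this level into
stub_windowOuterConvex / stub_hessianLowerBoundWithGhost / stub_herbstOnConvexBody / stub_meanModeGap (+ the landed S2).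

HONEST SCOPE.  A skeleton: S1 is a `sorry`; the crux, the route, the rung R3 stay OPEN; R3 is a RECORD rung of the programme, not the
Clay statement, and nothing here bears on the Yang–Mills mass gap.
-/

noncomputable section

open MeasureTheory ProbabilityTheory
open Literature.MathematicalPhysics.QuantumFieldTheory.Balaban1983to89
open Literature.MathematicalPhysics.QuantumFieldTheory.Balaban1983to89.Missing
open Literature.MathematicalPhysics.QuantumFieldTheory.Balaban1983to89.T4Continuum
open Literature.MathematicalPhysics.QuantumFieldTheory.Balaban1983to89.T3ContinuumYM3Torus
open Literature.MathematicalPhysics.QuantumFieldTheory.Balaban1983to89.T3UnitScaleTilt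
open Literature.MathematicalPhysics.QuantumFieldTheory.Balaban1983to89.T3UnitLawDensityEML (ℰp measurableE_ℰp)

namespace Summit.QuantumFields.YangMills.Theorems.FibreConvexityTail

/-- **STUB S1 `stub_fibreMGF` (registered signature, verbatim; OPEN — the XL lever).**  SUB-GAUSSIAN MOMENT BOUND ON THE TWO-SIDED
EVENT: for every block size `L` there is a profile floor `bmin` such that for every profile `b₀ ≥ bmin` (`0 < b₀`), `p₀ > 2` there is
`0 < γ₁ ≤ 1` and, for every family `F` with `F.L = L` and coupling `0 < γ ≤ γ₁`, constants `M ≥ 0`, `σ > 0` with, for every cut-off `K`,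
height `1 ≤ j`, `j + 2 ≤ K` and level-`j` plaquette `a`: `SubGaussianOnEvent F γ b₀ p₀ K j a M σ` — i.e. for all `t ≥ 0`,
`∫_{twoSidedEvent} exp(t·|Ū^{j}(∂a) − 1|/g_{K−j}) dGibbs_K ≤ M·exp(t·p(g_{K−j})/4 + σ²t²/2)`.  Intended proof: outer convex window `W⁺` in
Bałaban's regular chart of the constrained small-field fibre (`subGaussianOnEvent_of_superset` lets Herbst run on any `W⁺ ⊇` event), horizontal
Bakry–Émery κ-convexity of `βS − log J − ½ log det Δ_A` on `W⁺` with κ·L^{2(j+2)}/β_K ≥ κ₀ > 0, Herbst ⇒ σ² = 4L⁴g²/κ₀-type variance proxy,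
mean–mode gap ≤ p/4 (where `bmin` is spent).  NOT attempted in this skeleton (director: nothing on S1 before JOB B reports). -/
theorem stub_fibreMGF : ∀ (L : ℕ), ∃ bmin : ℝ, ∀ (b₀ p₀ : ℝ), bmin ≤ b₀ → 0 < b₀ → 2 < p₀ → ∃ γ₁ : ℝ, 0 < γ₁ ∧ γ₁ ≤ 1 ∧ ∀ (F : T3Family) (γ : ℝ), F.L = L → 0 < γ → γ ≤ γ₁ → ∃ (M σ : ℝ), 0 ≤ M ∧ 0 < σ ∧ ∀ (K j : ℕ), 1 ≤ j → j + 2 ≤ K → ∀ (a : Plaq (F.P K) j), SubGaussianOnEvent F γ b₀ p₀ K j a M σ := by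
  sorry

/-- **COMPOSITION `TwoSidedTailL_of`** — the crux `TwoSidedTailL` BY NAME from S1 (`stub_fibreMGF`, open) and the LANDED S2
(`stub_chernoffOnEvent`, p611300): thread `bmin`, `γ₁` from S1; for each `(F, γ)` take S1's `(M, σ)` and output the per-plaquette constants
`C = M`, `A = 0`, `c = 9/(32σ²)`; for each `(K, j, a)` apply S2 to S1's moment bound (`twoSidedTailL_iff` is `Iff.rfl`, so the crux's set
literal is `twoSidedEvent`).  Kernel-checked modulo the one `sorry` in S1. -/
theorem TwoSidedTailL_of : Summit.QuantumFields.YangMills.Theses.FibreConvexityTail.TwoSidedTailL := by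
  rw [twoSidedTailL_iff]
  intro L
  obtain ⟨bmin, hb⟩ := stub_fibreMGF L
  refine ⟨bmin, fun b₀ p₀ hbmin hb₀ hp₀ => ?_⟩
  obtain ⟨γ₁, hγ₁, hγ₁1, hF⟩ := hb b₀ p₀ hbmin hb₀ hp₀
  refine ⟨γ₁, hγ₁, hγ₁1, fun F γ hFL hγ hγle => ?_⟩
  obtain ⟨M, σ, hM, hσ, hK⟩ := hF F γ hFL hγ hγle
  refine ⟨M, 0, 9 / (32 * σ ^ 2), hM, by positivity, fun K j hj hjK a => ?_⟩
  exact stub_chernoffOnEvent F γ b₀ p₀ hγ hb₀ K j a M σ hM hσ (hK K j hj hjK a)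

end Summit.QuantumFields.YangMills.Theorems.FibreConvexityTail

end
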